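import Summits.ValiantsHypothesis.ValiantsHypothesis.Theorems.NcParseTreeNormalForm
import Summits.ValiantsHypothesis.ValiantsHypothesis.Theorems.NcTypedPermanentEventually
import HarnessLib

/-!
# Headlines rotUPT ⊆ rot-NF / UPT ⊆ UPT-NF, transfers to LID_r / PERM_n, eventually-forms

LLS18 = Lagarde–Limaye–Srinivasan 2018. THIS FILE (no definitions) assembles the parse-tree
semantics (`NcParseTrees`, `NcParseTreeValues`) and the conversion kernel (`NcParseTreeNormalForm`)
into the two headlines — a PRINT-rotUPT circuit (every parse tree a rotation of `T`; binary
products, no `const` operands) is computed by a `GateRot`-typed circuit of shape `T` with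
`3(2|T|−1)(s+1)` gates (`exists_rotNF_of_rotUPT`, LLS18 §4 with the Prop 7(2) bookkeeping), and a
PRINT-UPT circuit by a `GateTyped` one (`exists_uptNF_of_upt`, LLS18 Prop 7(2)) — then transfers
the landed typed lower bounds BY NAME (`lidPoly_rot`, `ncPerPoly_rot`, `ncPerPoly_upt`,
`size_eq_of_lid`) to the print classes (`lidPoly_rotUPT`, `ncPerPoly_rotUPT`, `ncPerPoly_uptPrint`)
and states the two rungs in eventually-form along `n = 4r` (`perNotNcRotUPT_eventually`,
`perNotNcUPT_eventually`; growth bookkeeping `growth96_eventually` from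
`pow_lt_two_pow_eventually`).
NON-VACUITY OF THE BINDERS: the `∀ r ≥ r₀` binders carry content for EVERY `r`: for every `r ≥ 1`
the circuit summing, over the `(4r)!` permutations, the left-comb binary product chains of the
`4r` variables of a monomial of `PERM_(4r)` (no `const` operands, products of fan-in 2) is
print-UPT of the left-comb shape — hence print-rotUPT — and computes `PERM_(4r)`, so at every `r`
the hypotheses are satisfiable and the conclusion `(4r)^c + c < P.size` is a genuine size statement.
DEGENERATE INSTANCES: `T = leaf` (every parse tree a single variable: constant-free linear forms)
is covered like any shape (`3(s+1)` gates); a circuit with 0 gates and output `var x` has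
`circuitPts = [(leaf, x)]`; an output (or operand) reference `.gate j` out of range has NO parse
trees, so the shape hypothesis holds vacuously there and both sides evaluate consistently (`0`);
no statement below has an `∃` over a size parameter — sizes are the explicit `3(2|T|−1)(s+1)`.
MODEL: PRINT rotUPT (LLS18 §4) for a circuit P in the tree's syntax := every PARSE TREE of P —
obtained by keeping one summand of every sum gate and both factors of every product gate, recorded
as (shape, coefficient•monomial) — has a shape that is a ROTATION (rotSim true) of one shape T;
PRINT UPT := every parse tree has shape T. Formalised for circuits whose product gates have fan-in
1 or 2 (copies and binary products; weighted sums of any fan-in; NO `const` operands — in print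
constants live on the + wires only, LLS18 p. 7); product fan-in ≥ 3 (allowed in print, removed by
LLS18 Lemma 8) is NOT covered (= option (c)); `nfConv rot T P` is GateRot-typed by T (GateTyped for
rot = false) UNCONDITIONALLY and computes the sum of those parse trees of P whose shape is ∼ T —
hence P.ncEval itself exactly when P is print-rotUPT of class [[T]]; size 3(2|T|−1)(P.size+1). The
transfers' constants (LID_r: 2^((r+1)/3) ≤ 96·r·r·(s+1); PERM_(4r): same; print-UPT: 2^(r+1) ≤
24·r·(s+1)) are WEAKER than lidPoly_rot / ncPerPoly_rot / ncPerPoly_upt — the content is the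
factorisation print-rotUPT → rot-NF → lidPoly_rot. NOT a new lower bound; 0 S-currency;
closes NO item; A_nc stmt-23446 / PerNotNcVP / VP ≠ VNP untouched.
[cite: LagardeLimayeSrinivasan2018, §3 Proposition 7, Theorem 10, §4 Theorem 17]
[cite: LimayeMalodSrinivasan2016, §7] [cite: HrubesWigdersonYehudayoff2010, Lemma C.5]
-/

namespace Summit.ValiantsHypothesis.ValiantsHypothesis.Theorems.NcParseTreePermanent

set_option linter.dupNamespace false
open Literature.Computability.AlgebraicComplexity
  Literature.Computability.AlgebraicComplexity.ArithCircuit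
  Summit.ValiantsHypothesis.ValiantsHypothesis.Theorems.NcBlockForms
  Summit.ValiantsHypothesis.ValiantsHypothesis.Theorems.NcCayleyDeterminant
  Summit.ValiantsHypothesis.ValiantsHypothesis.Theorems.NcSOSPermanent
  Summit.ValiantsHypothesis.ValiantsHypothesis.Theorems.NcUniqueParseTree
  Summit.ValiantsHypothesis.ValiantsHypothesis.Theorems.NcUniqueParseTreePermanent
  Summit.ValiantsHypothesis.ValiantsHypothesis.Theorems.NcRotParseTree
  Summit.ValiantsHypothesis.ValiantsHypothesis.Theorems.NcRotParseTreePermanent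
  Summit.ValiantsHypothesis.ValiantsHypothesis.Theorems.NcTypedPermanentEventually
  Summit.ValiantsHypothesis.ValiantsHypothesis.Theorems.NcParseTrees
  Summit.ValiantsHypothesis.ValiantsHypothesis.Theorems.NcParseTreeValues
  Summit.ValiantsHypothesis.ValiantsHypothesis.Theorems.NcParseTreeNormalForm

universe u v w

section Headlines
variable {R : Type u} [CommSemiring R] {σ : Type v}

/-- ★ **rotUPT ⊆ rot-NF IN KERNEL** (LLS18 §4 with Prop 7(2) bookkeeping): a circuit without
`const` operands whose product gates have fan-in 1 or 2 and ALL of whose parse trees are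
rotations of `T` is computed by a circuit rot-typed by `T` (`GateRot`, output typed by the
root) with `3(2|T|−1)(s+1)` gates (`Q = nfConv true T P`). MODEL clause: the print-rotUPT MODEL
of the module docstring (product fan-in ≥ 3 and untyped circuits NOT covered);
NOT a new lower bound; 0 S-currency; closes NO item; the transfers below are WEAKER in constant
than `lidPoly_rot`; A_nc stmt-23446 / PerNotNcVP / VP ≠ VNP untouched.
[cite: LagardeLimayeSrinivasan2018, §4 Theorem 17] -/
theorem exists_rotNF_of_rotUPT (P : ArithCircuit R σ)
    (hc : ∀ g ∈ P.gates, ∀ u ∈ g.args, ∀ c, u ≠ Operand.const c)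
    (hp : ∀ args, Gate.prod args ∈ P.gates → args.length = 1 ∨ args.length = 2)
    (ho : ∀ c, P.output ≠ Operand.const c) (T : Shape)
    (hT : ∀ e ∈ circuitPts P, rotSim true e.1 T = true) :
    ∃ (Q : ArithCircuit R σ) (ty : ℕ → List Bool),
      (∀ k (hk : k < Q.gates.length), GateRot T ty (ty k) Q.gates[k]) ∧
      OpTyped T ty [] Q.output ∧ Q.ncEval = P.ncEval ∧
      Q.size = 3 * (2 * T.size - 1) * (P.size + 1) :=
  ⟨nfConv true T P, nfTy T, (nfBlocks_typed true T (P.gates ++ [Gate.prod [P.output]])).1,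
    nfConv_output true T P,
    by rw [ncEval_nfConv, ptValAt_eq_ptVal hT, ptVal_circuitPts P hc hp ho],
    by rw [size_nfConv, (length_nodes T).1]⟩

/-- ★ **UPT ⊆ UPT-NF IN KERNEL** (LLS18 Prop 7(2)): all parse trees of shape `T` ⇒ computed by
a `GateTyped` circuit of shape `T` with `3(2|T|−1)(s+1)` gates (`Q = nfConv false T P`). MODEL
clause: the print-UPT MODEL of the module docstring; NOT a new lower bound; 0 S-currency;
closes NO item; the transfer below is WEAKER in constant than `ncPerPoly_upt`; A_nc stmt-23446 /
PerNotNcVP / VP ≠ VNP untouched. [cite: LagardeLimayeSrinivasan2018, §3 Proposition 7] -/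
theorem exists_uptNF_of_upt (P : ArithCircuit R σ)
    (hc : ∀ g ∈ P.gates, ∀ u ∈ g.args, ∀ c, u ≠ Operand.const c)
    (hp : ∀ args, Gate.prod args ∈ P.gates → args.length = 1 ∨ args.length = 2)
    (ho : ∀ c, P.output ≠ Operand.const c) (T : Shape)
    (hT : ∀ e ∈ circuitPts P, e.1 = T) :
    ∃ (Q : ArithCircuit R σ) (ty : ℕ → List Bool),
      (∀ k (hk : k < Q.gates.length), GateTyped T ty (ty k) Q.gates[k]) ∧
      OpTyped T ty [] Q.output ∧ Q.ncEval = P.ncEval ∧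
      Q.size = 3 * (2 * T.size - 1) * (P.size + 1) :=
  ⟨nfConv false T P, nfTy T, (nfBlocks_typed false T (P.gates ++ [Gate.prod [P.output]])).2,
    nfConv_output false T P,
    by rw [ncEval_nfConv, ptValAt_eq_ptVal (fun e he => (sim_false_iff e.1 T).2 (hT e he)),
      ptVal_circuitPts P hc hp ho],
    by rw [size_nfConv, (length_nodes T).1]⟩

end Headlines

/-- Arithmetic of the transfer: `4r · 3(8r−1)(s+1) ≤ 96·r·r·(s+1)`. [folklore] -/
theorem bound96 (r s : ℕ) : 4 * r * (3 * (2 * (4 * r) - 1) * (s + 1)) ≤ 96 * r * r * (s + 1) := by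
  have h : 3 * (2 * (4 * r) - 1) ≤ 24 * r := by omega
  calc 4 * r * (3 * (2 * (4 * r) - 1) * (s + 1)) ≤ 4 * r * (24 * r * (s + 1)) :=
        Nat.mul_le_mul_left _ (Nat.mul_le_mul_right _ h)
    _ = 96 * r * r * (s + 1) := by ring

section Transfer
variable (K : Type w) [Field K]

/-- ★ `LID_r` against PRINT-rotUPT circuits (binary products, no `const` operands): through the
conversion and `lidPoly_rot`; `|T| = 4r` by `size_eq_of_lid`. MODEL clause: the print-rotUPT
MODEL of the module docstring; NOT a new lower bound (a WEAKER constant than `lidPoly_rot`,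
which it invokes BY NAME); 0 S-currency; closes NO item; A_nc stmt-23446 / PerNotNcVP / VP ≠ VNP
untouched. [cite: LagardeLimayeSrinivasan2018, §4 Theorem 17] -/
theorem lidPoly_rotUPT {r : ℕ} (hr : 1 ≤ r) (P : ArithCircuit K (Fin 2))
    (hc : ∀ g ∈ P.gates, ∀ u ∈ g.args, ∀ c, u ≠ Operand.const c)
    (hp : ∀ args, Gate.prod args ∈ P.gates → args.length = 1 ∨ args.length = 2)
    (ho : ∀ c, P.output ≠ Operand.const c) (T : Shape)
    (hT : ∀ e ∈ circuitPts P, rotSim true e.1 T = true) (h : P.ncEval = lidPoly K r) :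
    2 ^ ((r + 1) / 3) ≤ 96 * r * r * (P.size + 1) := by
  obtain ⟨Q, ty, hg, hoQ, hQ, hs⟩ := exists_rotNF_of_rotUPT P hc hp ho T hT
  rw [h] at hQ
  have hTs := size_eq_of_lid K Q hg hoQ hQ
  have hle := lidPoly_rot K hr Q hg hoQ hQ
  rw [hs, hTs] at hle
  exact hle.trans (bound96 r P.size)

/-- ★ `PERM_{4r}` against PRINT-rotUPT circuits, through the conversion, `ncPerPoly_rot` and the
HWY lift (`liftSubst`, `perm_lift`, `size_eq_of_lid`, all BY NAME). MODEL clause: the print-rotUPT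
MODEL of the module docstring; NOT a new lower bound (a WEAKER constant than `ncPerPoly_rot`);
0 S-currency; closes NO item; A_nc stmt-23446 / PerNotNcVP / VP ≠ VNP untouched.
[cite: LagardeLimayeSrinivasan2018, §4 Theorem 17]
[cite: HrubesWigdersonYehudayoff2010, Lemma C.5] -/
theorem ncPerPoly_rotUPT {r : ℕ} (hr : 1 ≤ r) (P : ArithCircuit K (Fin (4 * r) × Fin (4 * r)))
    (hc : ∀ g ∈ P.gates, ∀ u ∈ g.args, ∀ c, u ≠ Operand.const c)
    (hp : ∀ args, Gate.prod args ∈ P.gates → args.length = 1 ∨ args.length = 2)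
    (ho : ∀ c, P.output ≠ Operand.const c) (T : Shape)
    (hT : ∀ e ∈ circuitPts P, rotSim true e.1 T = true)
    (h : P.ncEval = ncPerPoly K (4 * r)) : 2 ^ ((r + 1) / 3) ≤ 96 * r * r * (P.size + 1) := by
  obtain ⟨Q, ty, hg, hoQ, hQ, hs⟩ := exists_rotNF_of_rotUPT P hc hp ho T hT
  rw [h] at hQ
  have hφ : ∀ x c, liftSubst K r (4 * r) x = Sum.inr c → c = 0 := liftSubst_inr K
  have hL : (Q.substIn (liftSubst K r (4 * r))).ncEval = lidPoly K r := by
    rw [ncEval_substIn, hQ, perm_lift K (le_refl (4 * r))]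
  have hTs := size_eq_of_lid K (Q.substIn (liftSubst K r (4 * r))) (gates_substIn_rot Q hg hφ)
    (opTyped_substIn hoQ hφ) hL
  have hle := ncPerPoly_rot K hr Q hg hoQ hQ
  rw [hs, hTs] at hle
  exact hle.trans (bound96 r P.size)

/-- ★ `PERM_{4r}` against PRINT-UPT circuits (all parse trees of ONE shape), through the
conversion, `ncPerPoly_upt` and the HWY lift: `2^{r+1} ≤ 3(8r−1)(s+1) ≤ 24r(s+1)`. MODEL clause:
the print-UPT MODEL of the module docstring; NOT a new lower bound (a WEAKER constant than
`ncPerPoly_upt`); 0 S-currency; closes NO item; A_nc stmt-23446 / PerNotNcVP / VP ≠ VNP untouched.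
[cite: LagardeLimayeSrinivasan2018, §3 Theorem 10] [cite: HrubesWigdersonYehudayoff2010] -/
theorem ncPerPoly_uptPrint {r : ℕ} (hr : 1 ≤ r)
    (P : ArithCircuit K (Fin (4 * r) × Fin (4 * r)))
    (hc : ∀ g ∈ P.gates, ∀ u ∈ g.args, ∀ c, u ≠ Operand.const c)
    (hp : ∀ args, Gate.prod args ∈ P.gates → args.length = 1 ∨ args.length = 2)
    (ho : ∀ c, P.output ≠ Operand.const c) (T : Shape)
    (hT : ∀ e ∈ circuitPts P, e.1 = T) (h : P.ncEval = ncPerPoly K (4 * r)) :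
    2 ^ (r + 1) ≤ 24 * r * (P.size + 1) := by
  obtain ⟨Q, ty, hg, hoQ, hQ, hs⟩ := exists_uptNF_of_upt P hc hp ho T hT
  rw [h] at hQ
  have hφ : ∀ x c, liftSubst K r (4 * r) x = Sum.inr c → c = 0 := liftSubst_inr K
  have hL : (Q.substIn (liftSubst K r (4 * r))).ncEval = lidPoly K r := by
    rw [ncEval_substIn, hQ, perm_lift K (le_refl (4 * r))]
  have hTs := size_eq_of_lid K (Q.substIn (liftSubst K r (4 * r)))
    (gates_substIn_rot Q (fun k hk => GateRot.of_gateTyped (hg k hk)) hφ)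
    (opTyped_substIn hoQ hφ) hL
  have hle := ncPerPoly_upt K hr Q hg hoQ hQ
  rw [hs, hTs] at hle
  exact hle.trans (Nat.mul_le_mul_right _ (by omega))

end Transfer

/-- Growth bookkeeping, uniformly. [folklore] -/
theorem growth96_eventually (c : ℕ) : ∃ j₀ : ℕ, ∀ j, j₀ ≤ j →
    6 * (12 * j + 12) ^ 2 * ((12 * j + 12) ^ c + c + 1) < 2 ^ j := by
  obtain ⟨N, hN⟩ := pow_lt_two_pow_eventually (c + 3)
  refine ⟨N + 12 * 24 ^ (c + 2) + 1, fun j hj => ?_⟩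
  have hX : 12 * j + 12 ≤ 24 * j := by omega
  have h2c : c < 2 ^ c := Nat.lt_two_pow_self
  have hc : c + 1 ≤ (12 * j + 12) ^ c :=
    (Nat.succ_le_of_lt h2c).trans (Nat.pow_le_pow_left (show 2 ≤ 12 * j + 12 by omega) c)
  calc 6 * (12 * j + 12) ^ 2 * ((12 * j + 12) ^ c + c + 1)
      ≤ 6 * (12 * j + 12) ^ 2 * ((12 * j + 12) ^ c + (12 * j + 12) ^ c) :=
        Nat.mul_le_mul_left _ (by omega)
    _ = 12 * (12 * j + 12) ^ (c + 2) := by ring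
    _ ≤ 12 * (24 * j) ^ (c + 2) := Nat.mul_le_mul_left _ (Nat.pow_le_pow_left hX _)
    _ = 12 * 24 ^ (c + 2) * j ^ (c + 2) := by ring
    _ ≤ j * j ^ (c + 2) := Nat.mul_le_mul_right _ (by omega)
    _ = j ^ (c + 3) := by ring
    _ < 2 ^ j := hN j (by omega)

/-- ★ **PRINT-rotUPT rung, eventually-form along `n = 4r`** (LLS18 §4 Theorem 17 for binary
products; content = `ncPerPoly_rotUPT`; NON-VACUITY: for every `r ≥ 1` the sum over the `(4r)!`
permutations of the left-comb chains is such a circuit, module docstring). MODEL clause: the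
print-rotUPT MODEL of the module docstring; NOT a new lower bound (WEAKER in constant than the typed
rung `perNotNcRotVP_eventually`, same eventually-shape); 0 S-currency; closes NO item; A_nc
stmt-23446 / PerNotNcVP / VP ≠ VNP untouched. [cite: LagardeLimayeSrinivasan2018, §4 Theorem 17] -/
theorem perNotNcRotUPT_eventually (c : ℕ) : ∃ r₀ : ℕ, ∀ r, r₀ ≤ r →
    ∀ (P : ArithCircuit ℂ (Fin (4 * r) × Fin (4 * r))) (T : Shape),
      (∀ g ∈ P.gates, ∀ u ∈ g.args, ∀ c, u ≠ Operand.const c) →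
      (∀ args, Gate.prod args ∈ P.gates → args.length = 1 ∨ args.length = 2) →
      (∀ c, P.output ≠ Operand.const c) →
      (∀ e ∈ circuitPts P, rotSim true e.1 T = true) →
      P.ncEval = ncPerPoly ℂ (4 * r) → (4 * r) ^ c + c < P.size := by
  obtain ⟨j₀, hj₀⟩ := growth96_eventually c
  refine ⟨3 * j₀ + 3, fun r hr P T hc hp ho hT h => ?_⟩
  have hle := ncPerPoly_rotUPT ℂ (r := r) (by omega) P hc hp ho T hT h
  by_contra hcon
  have hS : P.size ≤ (4 * r) ^ c + c := Nat.not_lt.1 hcon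
  have hlt := hj₀ ((r + 1) / 3) (by omega)
  have hX : 4 * r ≤ 12 * ((r + 1) / 3) + 12 := by omega
  have h2 : 96 * r * r ≤ 6 * (12 * ((r + 1) / 3) + 12) ^ 2 := by
    rw [show 96 * r * r = 6 * (4 * r) ^ 2 by ring]
    exact Nat.mul_le_mul_left _ (Nat.pow_le_pow_left hX 2)
  have h3 : P.size + 1 ≤ (12 * ((r + 1) / 3) + 12) ^ c + c + 1 := by
    have h4 := Nat.pow_le_pow_left hX c
    omega
  exact absurd hlt (Nat.not_lt.2 (hle.trans (Nat.mul_le_mul h2 h3)))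

/-- ★ **PRINT-UPT rung, eventually-form along `n = 4r`** (LLS18 §3 Theorem 10 for binary
products; a print-UPT circuit is print-rotUPT by `sim_refl`). MODEL clause: the print-UPT MODEL of
the module docstring; NOT a new lower bound (WEAKER than the typed rung `perNotNcUptVP_eventually`);
0 S-currency; closes NO item; A_nc stmt-23446 / PerNotNcVP / VP ≠ VNP untouched.
[cite: LagardeLimayeSrinivasan2018, §3 Theorem 10] -/
theorem perNotNcUPT_eventually (c : ℕ) : ∃ r₀ : ℕ, ∀ r, r₀ ≤ r →
    ∀ (P : ArithCircuit ℂ (Fin (4 * r) × Fin (4 * r))) (T : Shape),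
      (∀ g ∈ P.gates, ∀ u ∈ g.args, ∀ c, u ≠ Operand.const c) →
      (∀ args, Gate.prod args ∈ P.gates → args.length = 1 ∨ args.length = 2) →
      (∀ c, P.output ≠ Operand.const c) →
      (∀ e ∈ circuitPts P, e.1 = T) →
      P.ncEval = ncPerPoly ℂ (4 * r) → (4 * r) ^ c + c < P.size := by
  obtain ⟨r₀, h₀⟩ := perNotNcRotUPT_eventually c
  exact ⟨r₀, fun r hr P T hc hp ho hT h =>
    h₀ r hr P T hc hp ho (fun e he => by rw [hT e he]; exact sim_refl true T) h⟩

end Summit.ValiantsHypothesis.ValiantsHypothesis.Theorems.NcParseTreePermanent
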